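import Summits.ResolutionOfSingularities.ResolutionOfSingularities.Theorems.FrobeniusLadderFRationalResolutionSingBlowupAtlasOffFinset
import Mathlib.Topology.JacobsonSpace
import HarnessLib

/-!
# Crux `FrobeniusLadder.FRationalResolution` (stmt-ResolutionOfSingularities-15317), line `redirect`,
# stub `stub_diagonalizableQuotientResolution` — design C3 off a finite set: THE EXCEPTIONAL POINTS ARE AUTOMATICALLY
# CLOSED (item J1 of memo MEMO-15317-leafhand2-g12: the hypothesis `hSc` of `…SingBlowupOffFinset` /
# `…SingBlowupAtlasOffFinset` is discharged by the Jacobson property)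

A scheme locally of finite type over a field is a Jacobson space (`LocallyOfFiniteType.jacobsonSpace`); a point `s`
which is the only singular point of an open `V ∋ s` has `{s} = V ∩ Sing X` locally closed, hence closed
(`isClosed_singleton_of_isLocallyClosed_singleton`). So the `hloc` datum of `…IsolatedGlue` at the points of the finite
exceptional set already forces them to be closed points:

* `isClosed_singleton_of_isolated_singular` — the statement above;
* **`hasResolution_of_finite_rank_two_atlas_off_finset'`** — `…SingBlowupAtlasOffFinset.hasResolution_of_finite_rank_two_atlas_off_finset`
  without the hypothesis `hSc`.

Honest label: plumbing toward ONE leaf stub (no stub, crux or summit closed). No definitions, no named facts, no sorry.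
[folklore; cite: StacksProject, Tag 01TB] [cite: Kato1994, Def. (2.1), (10.4)]
-/

noncomputable section

-- single-problem summit: the doubled namespace component is forced
set_option linter.dupNamespace false

open CategoryTheory CategoryTheory.Limits AlgebraicGeometry TopologicalSpace
open IsLocalRing Literature.AlgebraicGeometry.Resolution Literature.AlgebraicGeometry.Resolution.LogChart
open Summit.ResolutionOfSingularities.ResolutionOfSingularities.Theorems.FRationalResolution

namespace Summit.ResolutionOfSingularities.ResolutionOfSingularities.Theorems.FRationalResolution.SingBlowupOffFinsetClosed

/-- **An isolated singular point of a scheme locally of finite type over a field is a closed point**: `{s} = V ∩ Sing X`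
is locally closed (`V` open, `Sing X` closed — fields are J-2), and locally closed points of a Jacobson space are closed.
[folklore; cite: StacksProject, Tag 01TB] -/
theorem isClosed_singleton_of_isolated_singular {k : Type} [Field k] {X : Scheme.{0}} (f : X ⟶ Spec (.of k))
    [LocallyOfFiniteType f] {s : X} (hs : s ∉ Scheme.regularLocus X) (V : X.Opens) (hsV : s ∈ V)
    (hV : ∀ t : X, t ∉ Scheme.regularLocus X → t ∈ V → t = s) : IsClosed ({s} : Set X) := by
  haveI : JacobsonSpace X := LocallyOfFiniteType.jacobsonSpace f
  refine isClosed_singleton_of_isLocallyClosed_singleton ?_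
  have h : ({s} : Set X) = (V : Set X) ∩ (Scheme.regularLocus X)ᶜ := by
    ext t
    simp only [Set.mem_singleton_iff, Set.mem_inter_iff, Set.mem_compl_iff, SetLike.mem_coe]
    constructor
    · rintro rfl
      exact ⟨hsV, hs⟩
    · rintro ⟨htV, ht⟩
      exact hV t ht htV
  rw [h]
  exact V.isOpen.isLocallyClosed.inter (isOpen_regularLocus_of_locallyOfFiniteType_field f).isClosed_compl.isLocallyClosed

set_option maxHeartbeats 800000 in
/-- **A finite étale atlas of sharp rank-two log regular charts away from finitely many locally resolved singular points
resolves `X`** — `…SingBlowupAtlasOffFinset.hasResolution_of_finite_rank_two_atlas_off_finset` without the closedness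
hypothesis on the exceptional points (automatic, `isClosed_singleton_of_isolated_singular`).
[cite: Kato1994, Def. (2.1), (7.3), (10.1), (10.3), (10.4)] -/
theorem hasResolution_of_finite_rank_two_atlas_off_finset' {k : Type} [Field k] (X : Scheme.{0}) [IsIntegral X]
    (f : X ⟶ Spec (.of k)) [LocallyOfFiniteType f] [QuasiCompact f] (S : Finset X)
    (hS : ∀ s ∈ S, s ∉ Scheme.regularLocus X)
    (hloc : ∀ s ∈ S, ∃ (V : X.Opens), s ∈ V ∧
      (∀ t : X, t ∉ Scheme.regularLocus X → t ∈ V → t = s) ∧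
      ∃ (Y : Scheme.{0}) (ρ : Y ⟶ V), IsProper ρ ∧ Scheme.IsRegular Y ∧
        IsIso (ρ ∣_ (V.ι ⁻¹ᵁ ⟨Scheme.regularLocus X, isOpen_regularLocus_of_locallyOfFiniteType_field f⟩)) ∧
        Dense ((ρ ⁻¹ᵁ (V.ι ⁻¹ᵁ ⟨Scheme.regularLocus X,
          isOpen_regularLocus_of_locallyOfFiniteType_field f⟩) : Y.Opens) : Set Y))
    {ι : Type} [Finite ι] (A : ι → Type) [∀ i, CommRing (A i)] [∀ i, IsNoetherianRing (A i)]
    (P : ι → AddSubmonoid (Fin 2 → ℤ)) (φ : ∀ i, Multiplicative (P i) →* A i) (hP : ∀ i, (P i).FG)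
    (hsat : ∀ i, ∀ (w : Fin 2 → ℤ) (k : ℕ), 0 < k → k • w ∈ P i → w ∈ P i)
    (hspanP : ∀ i, Submodule.span ℤ (P i : Set (Fin 2 → ℤ)) = ⊤)
    (hsharp : ∀ i, ∀ p ∈ P i, -p ∈ P i → p = 0)
    (hreg : ∀ i, ∀ (𝔮 : Ideal (A i)) [𝔮.IsPrime], IsLogRegularAt (P i) (φ i) 𝔮)
    (H : ∀ x : X, x ∉ Scheme.regularLocus X → x ∉ S →
      ∃ (i : ι) (Y : Scheme.{0}) (ρ : Y ⟶ X) (_ : Etale ρ) (j : Y ⟶ Spec (.of (A i))) (_ : IsOpenImmersion j)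
        (y : Y), ρ y = x ∧ ∀ p : P i, (p : Fin 2 → ℤ) ≠ 0 → φ i (Multiplicative.ofAdd p) ∈ (j y).asIdeal) :
    Scheme.HasResolution X := by
  refine SingBlowupAtlasOffFinset.hasResolution_of_finite_rank_two_atlas_off_finset X f S (fun s hs => ?_) hS hloc
    A P φ hP hsat hspanP hsharp hreg H
  obtain ⟨V, hsV, hVS, -⟩ := hloc s hs
  exact isClosed_singleton_of_isolated_singular f (hS s hs) V hsV hVS

end Summit.ResolutionOfSingularities.ResolutionOfSingularities.Theorems.FRationalResolution.SingBlowupOffFinsetClosed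

end
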